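import Summits.ResolutionOfSingularities.ResolutionOfSingularities.Theorems.FrobeniusClosingSteerBinaryResidueRestriction
import Summits.ResolutionOfSingularities.ResolutionOfSingularities.Theorems.FrobeniusClosingSteerBinaryResidueAssembly
import Literature.AlgebraicGeometry.Resolution.RsopMonomialIdeals
import Mathlib.RingTheory.LocalRing.RingHom.Basic
import Mathlib.RingTheory.LocalRing.ResidueField.Basic
import HarnessLib

/-!
# hEv leaf [B] — kernel piece 3: the ADAPTED RATIONAL WINDOW KERNEL
# (an `m`-ary residue at the later member, read in the exceptional divisor, gives an `m`-ary residue at the earlier member;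
# Theses-free, def-free)

OURS (campaign `res-hironaka`, rung L ★L-G4, slot W4.1 · crux `Steer` (stmt-ResolutionOfSingularities-16345) · hEv leaf object
[B] = `BinaryResidueBackward` + `TangentialNeedsBinary` (res-L0-w41-idea-2 `HEV-IDEA-2.md` §2 Lemma 1 / Lemma 2 / cone condition),
kernel owner res-type-028 (res-L0-w41-plan-1 RULING 153a)). Not a statement of the manuscript under review [claim: Hironaka2017,
status: under-review]; AI-produced, weaker than expert review.

THE SETTING (an ADAPTED RATIONAL point window `S ≤ S' ⊆ L`, `char L = 2`). `S` local with `𝔪_S = (x, u₁, …, u_n)`, `S'` regular local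
of dimension `n + 1` with `𝔪_{S'} = (x, u'₁, …, u'_n)` where `u_j = x · u'_j` (the centre of `S'` is the origin of the `x`-chart: ADAPTED
coordinates), RATIONAL (`∀ a ∈ S', ∃ b ∈ S, a - b ∈ 𝔪_{S'}`), the stripping law `f' · x^d = f - g₀²` with `f - g₀² ∈ 𝔪_S^d`, `d = 2e`.

**Theorem `exists_sub_sq_mem_sup_of_window`** (the kernel). If at the later member
`f' - g'² ∈ (σ'₁, …, σ'_m)^d + 𝔪_{S'}^(d+1) + (x)` for some `g' ∈ S'` and `σ'_k ∈ 𝔪_{S'}`, then at the earlier member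
`f - (g₀ + G)² ∈ (σ₁, …, σ_m)^d + 𝔪_S^(d+1)` for some `G ∈ S` and `σ_k = Σ_j a_{kj} u_j ∈ (u₁, …, u_n)`.

Proof = piece 1 in `O = S' ⧸ (x)` (the local ring of the exceptional divisor at the centre — regular, rational over `κ = S/𝔪_S`, regular
parameters `ū'`; the `σ̄'_k` are linear forms `ℓ_k(ū')` modulo `𝔪_O²`; `f' ≡ C(u') (x)` for the dehomogenised initial form `C` of `f - g₀²`;
piece 1 gives `C̄ = q² + R(ℓ)` in `κ[T]`) + piece 2 at `S` (homogenised evaluation). USES: `m = 2`, `σ' = (σ', τ')` a binary residue at `S'`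
⇒ LEMMA 1 (`BinaryResidueBackward`) for adapted rational windows; `m = n`, `σ' = u'` (hypothesis `f' - g'² ∈ 𝔪_{S'}^d`, i.e. cleaned order
`≥ d` at `S'`) ⇒ the CONE CONDITION `f - (g₀ + G)² ∈ (u₁, …, u_n)^d + 𝔪_S^(d+1)`, the input of LEMMA 2 (`TangentialNeedsBinary`).

* §1 `pow_le_pow_sup_pow_succ` — `I ≤ J + M², J ≤ M ⇒ I^d ≤ J^d + M^(d+1)`; `totalDegree_bind₁_le_of_le_one`.
* §2 the quotient `O = S' ⧸ (x)`: regular, dimension, parameters, rationality over `κ` (`exists_residue_sub_mem_of_rational`).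
* §3 the kernel `exists_sub_sq_mem_sup_of_window` and its cone reading `exists_sub_sq_mem_span_pow_sup_of_window`.
[cite: Matsumura1987, Thm. 14.2, Thm. 17.10] [folklore]
-/

noncomputable section

-- `Summit.<S>.<S>.…` duplicates the summit name by design (single-problem summit).
set_option linter.dupNamespace false

open IsLocalRing MvPolynomial

namespace Summit.ResolutionOfSingularities.ResolutionOfSingularities.Theorems.SwitchingDichotomy.BinaryResidue

open Literature.AlgebraicGeometry.Resolution

universe u

/-! ## §1 Two generic lemmas -/

/-- `I ≤ J + M²` and `J ≤ M` give `I^d ≤ J^d + M^(d+1)`: generators may be perturbed by `M²` without changing `J^d + M^(d+1)`.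
[folklore] -/
theorem pow_le_pow_sup_pow_succ {A : Type*} [CommRing A] {I J M : Ideal A} (hIJ : I ≤ J ⊔ M ^ 2) (hJ : J ≤ M) (d : ℕ) :
    I ^ d ≤ J ^ d ⊔ M ^ (d + 1) := by
  induction d with
  | zero => simp
  | succ d ih =>
    calc I ^ (d + 1) = I * I ^ d := pow_succ' I d
      _ ≤ (J ⊔ M ^ 2) * (J ^ d ⊔ M ^ (d + 1)) := Ideal.mul_mono hIJ ih
      _ ≤ J ^ (d + 1) ⊔ M ^ (d + 1 + 1) := by
        rw [Ideal.sup_mul, Ideal.mul_sup, Ideal.mul_sup]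
        refine sup_le (sup_le ?_ ?_) (sup_le ?_ ?_)
        · rw [← pow_succ']
          exact le_sup_left
        · refine le_sup_of_le_right ?_
          calc J * M ^ (d + 1) ≤ M * M ^ (d + 1) := Ideal.mul_mono_left hJ
            _ = M ^ (d + 1 + 1) := (pow_succ' M (d + 1)).symm
        · refine le_sup_of_le_right ?_
          calc M ^ 2 * J ^ d ≤ M ^ 2 * M ^ d := Ideal.mul_mono_right (Ideal.pow_right_mono hJ d)
            _ = M ^ (d + 1 + 1) := by rw [← pow_add]; ring_nf
        · refine le_sup_of_le_right ?_
          rw [← pow_add]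
          exact Ideal.pow_le_pow_right (by omega)

/-- Substituting polynomials of total degree `≤ 1` does not raise the total degree. [folklore] -/
theorem totalDegree_bind₁_le_of_le_one {σ τ : Type*} {A : Type*} [CommRing A] {g : σ → MvPolynomial τ A}
    (hg : ∀ i, (g i).totalDegree ≤ 1) (φ : MvPolynomial σ A) : (bind₁ g φ).totalDegree ≤ φ.totalDegree := by
  classical
  have hφ : bind₁ g φ = ∑ β ∈ φ.support, MvPolynomial.C (φ.coeff β) * ∏ i ∈ β.support, g i ^ β i := by
    conv_lhs => rw [φ.as_sum]
    rw [map_sum]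
    refine Finset.sum_congr rfl fun β _ => ?_
    rw [bind₁_monomial]
  rw [hφ]
  refine totalDegree_finsetSum_le fun β hβ => ?_
  refine (totalDegree_mul _ _).trans ?_
  rw [totalDegree_C, zero_add]
  refine (totalDegree_finsetProd _ _).trans ?_
  calc ∑ i ∈ β.support, (g i ^ β i).totalDegree ≤ ∑ i ∈ β.support, β i := by
        refine Finset.sum_le_sum fun i _ => (totalDegree_pow _ _).trans ?_
        calc β i * (g i).totalDegree ≤ β i * 1 := Nat.mul_le_mul_left _ (hg i)
          _ = β i := mul_one _
    _ ≤ φ.totalDegree := le_totalDegree hβ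

/-! ## §2 The local ring of the exceptional divisor at an adapted rational centre -/

section quotient

variable {S' : Type u} [CommRing S'] [IsLocalRing S']

/-- The first member of a regular system of parameters is part of it (bookkeeping for `IsRsopPart ![x]`). [folklore] -/
theorem isRsopPart_singleton_of_span_insert (hreg : IsRegularLocalRing S') {n : ℕ} (x : S') (u' : Fin n → S')
    (hm : Ideal.span (insert x (Set.range u')) = maximalIdeal S') (hdim : ringKrullDim S' = (n + 1 : ℕ)) :
    IsRsopPart ![x] := by
  refine ⟨hreg, n, u', by rw [hdim]; norm_cast; ring, ?_⟩
  rw [← hm]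
  congr 1
  ext a
  simp

/-- `ringKrullDim` bookkeeping: `a + 1 = n + 1` in `WithBot ℕ∞` forces `a = n`. [folklore] -/
theorem withBotENat_eq_of_add_one_eq {a : WithBot ℕ∞} {n : ℕ} (h : a + 1 = (n + 1 : ℕ)) : a = n := by
  induction a with
  | bot =>
    rw [WithBot.bot_add, ← WithBot.coe_natCast] at h
    exact absurd h WithBot.bot_ne_coe
  | coe a =>
    induction a with
    | top =>
      rw [← WithBot.coe_one, ← WithBot.coe_add, top_add, ← WithBot.coe_natCast] at h
      exact absurd (WithBot.coe_injective h) (ENat.top_ne_coe _)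
    | coe a =>
      have : ((a + 1 : ℕ) : WithBot ℕ∞) = ((n + 1 : ℕ) : WithBot ℕ∞) := by
        rw [← h]; norm_cast
      have := (Nat.cast_inj (R := WithBot ℕ∞)).mp this
      have : a = n := by omega
      subst this; rfl

/-- **The exceptional divisor at an adapted centre.** If `𝔪_{S'} = (x, u'₁, …, u'_n)` with `S'` regular of dimension `n + 1`, then
`O = S' ⧸ (x)` is a regular local ring of embedding dimension `n` whose maximal ideal is generated by the images `ū'`.
[cite: Matsumura1987, Thm. 14.2] -/
theorem quotient_span_singleton_rsop (hreg : IsRegularLocalRing S') {n : ℕ} (x : S') (u' : Fin n → S')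
    (hm : Ideal.span (insert x (Set.range u')) = maximalIdeal S') (hdim : ringKrullDim S' = (n + 1 : ℕ)) :
    ∃ _ : IsRegularLocalRing (S' ⧸ Ideal.span (Set.range ![x])),
      (maximalIdeal (S' ⧸ Ideal.span (Set.range ![x]))).spanFinrank = n ∧
      Ideal.span (Set.range (Ideal.Quotient.mk (Ideal.span (Set.range ![x])) ∘ u')) =
        maximalIdeal (S' ⧸ Ideal.span (Set.range ![x])) := by
  have hx : IsRsopPart ![x] := isRsopPart_singleton_of_span_insert hreg x u' hm hdim
  haveI hO : IsRegularLocalRing (S' ⧸ Ideal.span (Set.range ![x])) := hx.isRegularLocalRing_quotient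
  have hdimO : ringKrullDim (S' ⧸ Ideal.span (Set.range ![x])) = n := by
    have h := hx.ringKrullDim_quotient_add
    rw [hdim] at h
    exact withBotENat_eq_of_add_one_eq (by exact_mod_cast h)
  refine ⟨hO, ?_, ?_⟩
  · have h := IsRegularLocalRing.spanFinrank_maximalIdeal (R := S' ⧸ Ideal.span (Set.range ![x]))
    rw [hdimO] at h
    exact_mod_cast h
  · rw [← map_maximalIdeal_of_surjective (Ideal.Quotient.mk (Ideal.span (Set.range ![x])))
      Ideal.Quotient.mk_surjective, ← hm, Ideal.map_span, Set.image_insert_eq, Set.range_comp]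
    have h0 : Ideal.Quotient.mk (Ideal.span (Set.range ![x])) x = 0 :=
      Ideal.Quotient.eq_zero_iff_mem.mpr (Ideal.subset_span ⟨0, rfl⟩)
    rw [h0]
    exact (Ideal.span_insert_zero).symm

end quotient

/-! ## §3 The kernel -/

section kernel

variable {L : Type} [Field L]

/-- **The adapted rational window kernel.** See the module docstring. [cite: Matsumura1987, Thm. 14.2, Thm. 17.10] [folklore] -/
theorem exists_sub_sq_mem_sup_of_window (h2 : (2 : L) = 0) (S S' : Subring L) [IsLocalRing S] [IsLocalRing S']
    (hle : S ≤ S') (hreg' : IsRegularLocalRing S') {n : ℕ} (hdim' : ringKrullDim S' = (n + 1 : ℕ))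
    (x : S) (hx0 : (x : L) ≠ 0) (u : Fin n → S) (hxu : Ideal.span (insert x (Set.range u)) = maximalIdeal S)
    (u' : Fin n → S') (hu : ∀ j, ((u j : S) : L) = (x : L) * ((u' j : S') : L))
    (hm' : Ideal.span (insert (⟨(x : L), hle x.2⟩ : S') (Set.range u')) = maximalIdeal S')
    (hrat : ∀ a : S', ∃ b : S, a - ⟨(b : L), hle b.2⟩ ∈ maximalIdeal S')
    {d e : ℕ} (hde : d = 2 * e) (f g₀ : S) (f' : S')
    (hlaw : ((f' : S') : L) * (x : L) ^ d = ((f : S) : L) - ((g₀ : S) : L) ^ 2)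
    (hFd : f - g₀ ^ 2 ∈ maximalIdeal S ^ d)
    {m : ℕ} (σ' : Fin m → S') (hσ' : ∀ k, σ' k ∈ maximalIdeal S') (g' : S')
    (h : f' - g' ^ 2 ∈ Ideal.span (Set.range σ') ^ d ⊔ maximalIdeal S' ^ (d + 1) ⊔
      Ideal.span {(⟨(x : L), hle x.2⟩ : S')}) :
    ∃ (a : Fin m → Fin n → S) (G : S),
      f - (g₀ + G) ^ 2 ∈ Ideal.span (Set.range fun k => ∑ j, a k j * u j) ^ d ⊔ maximalIdeal S ^ (d + 1) := by
  classical
  set x' : S' := ⟨(x : L), hle x.2⟩ with hx'def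
  set I : Ideal S' := Ideal.span (Set.range ![x']) with hIdef
  have hx'I : x' ∈ I := Ideal.subset_span ⟨0, rfl⟩
  -- §2: the quotient `O`
  obtain ⟨hO, hn, hū⟩ := quotient_span_singleton_rsop hreg' x' u' hm' hdim'
  set O := S' ⧸ I
  set mk : S' →+* O := Ideal.Quotient.mk I with hmkdef
  set ū : Fin n → O := mk ∘ u' with hūdef
  haveI : IsRegularLocalRing O := hO
  -- `κ = S/𝔪_S` maps to `O` (`𝔪_S ⊆ (x) S'`)
  set incl : S →+* S' := Subring.inclusion hle with hincl
  have hxm : x ∈ maximalIdeal S := hxu ▸ Ideal.subset_span (Set.mem_insert _ _)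
  have hum : ∀ j, u j ∈ maximalIdeal S := fun j => hxu ▸ Ideal.subset_span (Set.mem_insert_of_mem _ ⟨j, rfl⟩)
  have hker : ∀ a ∈ maximalIdeal S, (mk.comp incl) a = 0 := by
    intro a ha
    rw [← hxu] at ha
    rw [RingHom.comp_apply, hmkdef, Ideal.Quotient.eq_zero_iff_mem]
    refine Submodule.span_induction ?_ (by simp) (fun a b _ _ ha hb => ?_) (fun r a _ ha => ?_) ha
    · rintro a (rfl | ⟨j, rfl⟩)
      · exact hx'I
      · have : incl (u j) = x' * u' j := Subtype.ext (by rw [hincl, Subring.coe_inclusion]; exact hu j)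
        rw [this]
        exact I.mul_mem_right _ hx'I
    · rw [map_add]; exact add_mem ha hb
    · rw [smul_eq_mul, map_mul]; exact I.mul_mem_left _ ha
  set ι₀ : ResidueField S →+* O := Ideal.Quotient.lift (maximalIdeal S) (mk.comp incl) hker with hι₀
  letI : Algebra (ResidueField S) O := ι₀.toAlgebra
  have hι₀res : ∀ b : S, algebraMap (ResidueField S) O (residue S b) = mk (incl b) := fun b => by
    show ι₀ (residue S b) = _
    rw [hι₀]; rfl
  have hratO : ∀ o : O, ∃ c : ResidueField S, o - algebraMap (ResidueField S) O c ∈ maximalIdeal O := by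
    intro o
    obtain ⟨a, rfl⟩ := Ideal.Quotient.mk_surjective (I := I) o
    obtain ⟨b, hb⟩ := hrat a
    refine ⟨residue S b, ?_⟩
    rw [hι₀res, ← map_maximalIdeal_of_surjective mk Ideal.Quotient.mk_surjective]
    change mk a - mk (incl b) ∈ _
    rw [← map_sub]
    exact Ideal.mem_map_of_mem _ hb
  have h2S' : (2 : S') = 0 := by
    apply Subtype.ext
    change S'.subtype 2 = S'.subtype 0
    rw [map_ofNat, map_zero]; exact h2
  have h2O : (2 : O) = 0 := by rw [← map_ofNat mk 2, h2S', map_zero]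
  have h2S : (2 : S) = 0 := by
    apply Subtype.ext
    change S.subtype 2 = S.subtype 0
    rw [map_ofNat, map_zero]; exact h2
  -- §3a: the hypothesis in `O`
  set σbar : Fin m → O := mk ∘ σ' with hσbar
  have hO1 : mk f' - mk g' ^ 2 ∈ Ideal.span (Set.range σbar) ^ d ⊔ maximalIdeal O ^ (d + 1) := by
    have := Ideal.mem_map_of_mem mk h
    rw [Ideal.map_sup, Ideal.map_sup, Ideal.map_pow, Ideal.map_pow, Ideal.map_span, ← Set.range_comp,
      map_maximalIdeal_of_surjective mk Ideal.Quotient.mk_surjective, Ideal.map_span, Set.image_singleton,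
      (Ideal.Quotient.eq_zero_iff_mem.mpr hx'I : mk x' = 0), Ideal.span_singleton_zero, sup_bot_eq,
      map_sub, map_pow] at this
    exact this
  -- §3b: linear parts of the `σ̄'_k`
  have hlin : ∀ k, ∃ c : Fin n → ResidueField S,
      σbar k - aeval ū (∑ j, MvPolynomial.C (c j) * X j) ∈ maximalIdeal O ^ 2 := by
    intro k
    have hk : σbar k ∈ Ideal.span (Set.range ū) := by
      rw [hū, ← map_maximalIdeal_of_surjective mk Ideal.Quotient.mk_surjective]
      exact Ideal.mem_map_of_mem _ (hσ' k)
    obtain ⟨o, ho⟩ := (Ideal.mem_span_range_iff_exists_fun (R := O)).mp hk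
    choose c hc using fun j => hratO (o j)
    refine ⟨c, ?_⟩
    have : σbar k - aeval ū (∑ j, MvPolynomial.C (c j) * X j) =
        ∑ j, (o j - algebraMap (ResidueField S) O (c j)) * ū j := by
      simp only [map_sum, map_mul, algHom_C, aeval_X, ← ho, sub_mul, Finset.sum_sub_distrib]
    rw [this, pow_two]
    exact Ideal.sum_mem _ fun j _ => Ideal.mul_mem_mul (hc j) (hū ▸ Ideal.subset_span ⟨j, rfl⟩)
  choose c hc using hlin
  set ℓ : Fin m → MvPolynomial (Fin n) (ResidueField S) := fun k => ∑ j, MvPolynomial.C (c k j) * X j with hℓ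
  have hℓ1 : ∀ k, (ℓ k).IsHomogeneous 1 := fun k => isHomogeneous_one_sum_C_mul_X (c k)
  have hvm : Ideal.span (Set.range fun k => aeval ū (ℓ k)) ≤ maximalIdeal O := by
    rw [Ideal.span_le]
    rintro _ ⟨k, rfl⟩
    have := eval_mem_span_pow ū ((hℓ1 k).map (algebraMap (ResidueField S) O))
    rw [eval_map, ← aeval_def, pow_one, hū] at this
    exact this
  have hO2 : mk f' - mk g' ^ 2 ∈ Ideal.span (Set.range fun k => aeval ū (ℓ k)) ^ d ⊔ maximalIdeal O ^ (d + 1) := by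
    have hle' : Ideal.span (Set.range σbar) ≤ Ideal.span (Set.range fun k => aeval ū (ℓ k)) ⊔ maximalIdeal O ^ 2 := by
      rw [Ideal.span_le]
      rintro _ ⟨k, rfl⟩
      have : σbar k = aeval ū (ℓ k) + (σbar k - aeval ū (ℓ k)) := by ring
      rw [SetLike.mem_coe, this]
      exact add_mem (Ideal.mem_sup_left (Ideal.subset_span ⟨k, rfl⟩)) (Ideal.mem_sup_right (hc k))
    have hpow := pow_le_pow_sup_pow_succ hle' hvm d
    obtain ⟨y, hy, w, hw, hyw⟩ := Submodule.mem_sup.mp hO1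
    rw [← hyw]
    obtain ⟨y₁, hy₁, y₂, hy₂, rfl⟩ := Submodule.mem_sup.mp (hpow hy)
    rw [add_assoc]
    exact add_mem (Ideal.mem_sup_left hy₁) (Ideal.mem_sup_right (add_mem hy₂ hw))
  -- §3c: the dehomogenised initial form `C` with `f' = C(u')`
  set xu : Fin (n + 1) → S := Fin.cons x u with hxudef
  have hFd' : f - g₀ ^ 2 ∈ Ideal.span (Set.range xu) ^ d := by
    rwa [hxudef, Fin.range_cons, hxu]
  obtain ⟨Φ, hΦ, hΦev⟩ := exists_isHomogeneous_of_mem_span_pow xu d hFd'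
  set C : MvPolynomial (Fin n) S := bind₁ (Fin.cons 1 X : Fin (n + 1) → MvPolynomial (Fin n) S) Φ with hCdef
  have hC : C.totalDegree ≤ d := by
    refine (totalDegree_bind₁_le_of_le_one (fun i => ?_) Φ).trans hΦ.totalDegree_le
    refine Fin.cases ?_ (fun j => ?_) i
    · simp
    · simp [totalDegree_X]
  set uL : Fin n → L := fun j => ((u' j : S') : L) with huL
  have hcons : (⇑S.subtype ∘ xu) = (x : L) • (Fin.cons 1 uL : Fin (n + 1) → L) := by
    funext i
    refine Fin.cases ?_ (fun j => ?_) i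
    · simp [hxudef]
    · simp [hxudef, huL, hu j]
  have hfun : (fun i => eval₂Hom S.subtype uL ((Fin.cons 1 X : Fin (n + 1) → MvPolynomial (Fin n) S) i)) =
      (Fin.cons 1 uL : Fin (n + 1) → L) := by
    funext i
    refine Fin.cases ?_ (fun j => ?_) i
    · simp
    · simp
  have hevC : eval₂ S.subtype uL C = eval₂ S.subtype (Fin.cons 1 uL : Fin (n + 1) → L) Φ := by
    rw [hCdef]
    change eval₂Hom S.subtype uL (bind₁ (Fin.cons 1 X) Φ) = eval₂Hom S.subtype (Fin.cons 1 uL) Φ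
    rw [eval₂Hom_bind₁, hfun]
  have hF : S.subtype (f - g₀ ^ 2) = S.subtype x ^ d * eval₂ S.subtype uL C := by
    rw [← hΦev, show eval xu Φ = eval₂ (RingHom.id S) xu Φ from rfl,
      eval₂_comp_left, RingHom.comp_id, hcons, eval₂_smul_eq S.subtype hΦ, hevC]
    rfl
  have hf'L : ((f' : S') : L) = eval₂ S.subtype uL C := by
    have h1 : ((f' : S') : L) * (x : L) ^ d = (x : L) ^ d * eval₂ S.subtype uL C := by
      rw [hlaw]; exact hF
    have hxd : (x : L) ^ d ≠ 0 := pow_ne_zero _ hx0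
    calc ((f' : S') : L) = ((f' : S') : L) * (x : L) ^ d / (x : L) ^ d := by field_simp
      _ = eval₂ S.subtype uL C := by rw [h1]; field_simp
  have hf'S' : f' = eval₂ incl u' C := by
    apply Subtype.ext
    rw [hf'L, show ((eval₂ incl u' C : S') : L) = S'.subtype (eval₂ incl u' C) from rfl, eval₂_comp_left]
    rfl
  have hmkf' : mk f' = aeval ū (map (residue S) C) := by
    rw [hf'S', eval₂_comp_left, aeval_def, eval₂_map]
    congr 1
  -- §3d: piece 1 in `O`
  have hCbar : (map (residue S) C).totalDegree ≤ d :=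
    le_trans (Finset.sup_mono (support_map_subset _ _)) hC
  obtain ⟨q, hq, R, hR, hid⟩ := eq_sq_add_bind₁_of_sub_sq_mem h2O hn ū hū hratO hde (map (residue S) C) hCbar
    (mk g') ℓ hℓ1 (hmkf' ▸ hO2)
  -- §3e: piece 2 at `S`
  obtain ⟨a, -, G, hG⟩ := exists_sub_sq_mem_sup_of_map_residue_eq S.subtype Subtype.coe_injective hxm hum uL
    (fun j => hu j) hde C hC (f - g₀ ^ 2) hF q hq c R hR hid
  refine ⟨a, G, ?_⟩
  have : f - (g₀ + G) ^ 2 = f - g₀ ^ 2 - G ^ 2 - 2 * (g₀ * G) := by ring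
  rwa [this, h2S, zero_mul, sub_zero]

/-- **Cone reading of the kernel** (`σ' = u'`, `m = n`): cleaned order `≥ d` at the later member of an adapted rational window
(`f' - g'² ∈ 𝔪_{S'}^d`) puts a cleaning of `f` into `(u₁, …, u_n)^d + 𝔪_S^(d+1)` — the initial form of the cleaned radicand is,
modulo squares, a CONE over the centre (HEV-IDEA-2 §1 cone condition / idea-3 HNT4 (T2)). [cite: Matsumura1987, Thm. 17.10] [folklore] -/
theorem exists_sub_sq_mem_span_pow_sup_of_window (h2 : (2 : L) = 0) (S S' : Subring L) [IsLocalRing S] [IsLocalRing S']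
    (hle : S ≤ S') (hreg' : IsRegularLocalRing S') {n : ℕ} (hdim' : ringKrullDim S' = (n + 1 : ℕ))
    (x : S) (hx0 : (x : L) ≠ 0) (u : Fin n → S) (hxu : Ideal.span (insert x (Set.range u)) = maximalIdeal S)
    (u' : Fin n → S') (hu : ∀ j, ((u j : S) : L) = (x : L) * ((u' j : S') : L))
    (hm' : Ideal.span (insert (⟨(x : L), hle x.2⟩ : S') (Set.range u')) = maximalIdeal S')
    (hrat : ∀ a : S', ∃ b : S, a - ⟨(b : L), hle b.2⟩ ∈ maximalIdeal S')
    {d e : ℕ} (hde : d = 2 * e) (f g₀ : S) (f' : S')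
    (hlaw : ((f' : S') : L) * (x : L) ^ d = ((f : S) : L) - ((g₀ : S) : L) ^ 2)
    (hFd : f - g₀ ^ 2 ∈ maximalIdeal S ^ d) (g' : S') (h : f' - g' ^ 2 ∈ maximalIdeal S' ^ d) :
    ∃ G : S, f - (g₀ + G) ^ 2 ∈ Ideal.span (Set.range u) ^ d ⊔ maximalIdeal S ^ (d + 1) := by
  set x' : S' := ⟨(x : L), hle x.2⟩ with hx'def
  have hu'm : ∀ k, u' k ∈ maximalIdeal S' := fun k => hm' ▸ Ideal.subset_span (Set.mem_insert_of_mem _ ⟨k, rfl⟩)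
  -- `𝔪_{S'}^d ≤ (u')^d + (x')`
  have hXU : ∀ k : ℕ, (Ideal.span {x'} ⊔ Ideal.span (Set.range u')) ^ k ≤
      Ideal.span (Set.range u') ^ k ⊔ Ideal.span {x'} := by
    intro k
    induction k with
    | zero => simp
    | succ k ih =>
      calc (Ideal.span {x'} ⊔ Ideal.span (Set.range u')) ^ (k + 1)
          = (Ideal.span {x'} ⊔ Ideal.span (Set.range u')) * (Ideal.span {x'} ⊔ Ideal.span (Set.range u')) ^ k :=
            pow_succ' _ _
        _ ≤ (Ideal.span {x'} ⊔ Ideal.span (Set.range u')) * (Ideal.span (Set.range u') ^ k ⊔ Ideal.span {x'}) :=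
            Ideal.mul_mono_right ih
        _ ≤ Ideal.span (Set.range u') ^ (k + 1) ⊔ Ideal.span {x'} := by
            rw [Ideal.sup_mul, Ideal.mul_sup, Ideal.mul_sup]
            refine sup_le (sup_le (Ideal.mul_le_right.trans le_sup_right) (Ideal.mul_le_right.trans le_sup_right))
              (sup_le ?_ (Ideal.mul_le_left.trans le_sup_right))
            rw [← pow_succ']
            exact le_sup_left
  have hmd : maximalIdeal S' ^ d ≤ Ideal.span (Set.range u') ^ d ⊔ maximalIdeal S' ^ (d + 1) ⊔ Ideal.span {x'} := by
    rw [← hm', Set.insert_eq, Ideal.span_union]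
    refine (hXU d).trans (sup_le (le_sup_of_le_left le_sup_left) le_sup_right)
  obtain ⟨a, G, hG⟩ := exists_sub_sq_mem_sup_of_window h2 S S' hle hreg' hdim' x hx0 u hxu u' hu hm' hrat hde f g₀ f'
    hlaw hFd u' hu'm g' (hmd h)
  refine ⟨G, ?_⟩
  have hsub : Ideal.span (Set.range fun k => ∑ j, a k j * u j) ≤ Ideal.span (Set.range u) := by
    rw [Ideal.span_le]
    rintro _ ⟨k, rfl⟩
    exact Ideal.sum_mem _ fun j _ => Ideal.mul_mem_left _ _ (Ideal.subset_span ⟨j, rfl⟩)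
  exact sup_le_sup_right (Ideal.pow_right_mono hsub d) _ hG

end kernel

end Summit.ResolutionOfSingularities.ResolutionOfSingularities.Theorems.SwitchingDichotomy.BinaryResidue

end
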